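import Literature.AlgebraicGeometry.Motives.AbelianVarietyVerschiebung
import Literature.AlgebraicGeometry.Motives.AbelianVarietyEtaleIsogenyFrobeniusKernel
import HarnessLib

/-!
# The Frobenius kernel `A[F_q]` of an abelian variety: a one-point closed subgroup of `A[q]`, trivial towards étale group schemes

Topic `Literature/AlgebraicGeometry/Motives`; namespaces `Literature.AlgebraicGeometry.GroupSchemes.GroupSchemeKernel` (§1, generic) and
`Literature.AlgebraicGeometry.Motives.AbelianVariety` (§2–§3).  THEOREMS ONLY (no definition, no named fact, no instance, no notation,
no `sorry`).  Cell `hodgecm-mathlib` (D-0151), FLOOR 0, P6 «MOD programme» (crux hLiu418 = stmt-HodgeConjecture-24832, `--supports`):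
organ **(FK0) + (FK∞) + (ÉT)** of the K∕BT desk's cut ST1-CUT v1 §1 (desk F0P6d-plan (g0), 2026-09-01) of ST-1 «Frobenius kernels of the
blocks» (desk F0P6a-plan (g0), ED3-CENSUS-P6a v1 §3): the two facts about the Frobenius kernel `A[F_q] := Ker (F^{(r)}_{A∕k} : A → A^{(q)})`,
`q = p^r`, that the heart's identification `A^{(q)} ≅ A″` (HEART-FROB) reads block by block — **(FK0) `A[F_q] ⊆ A[q]`** and **(FK∞) `A[F_q]`
has one point** — and the corollary **(ÉT) «`A[F_q]` maps trivially to every étale group scheme»** (so its component in an étale block of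
`A[p^∞]` is trivial).  HC_CM is proved only modulo the printed citations until rung 0 closes; this file is generic and changes no count.

THE PRINT.  [MumfordAV1970] §15 (p. 146) and [EdixhovenVanDerGeerMoonenAV] Ch. 5 §2: over a perfect field `k` of characteristic `p` the
relative Frobenius `F_{A∕k} : A → A^{(p)}` is a purely inseparable isogeny and `V ∘ F = [p]_A` for the Verschiebung `V : A^{(p)} → A`;
iterating, `[p^r]_A = F^{(r)}_{A∕k} ≫ V^{(r)}` (★ `AbelianVariety.existsUnique_relFrobenius_comp_eq_pow_zsmul_id`).  Hence (FK0): a point of `A`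
killed by `F^{(r)}` is killed by `[p^r]`, i.e. `Ker F^{(r)} ⊆ A[p^r]` as closed subgroup schemes ([GortzWedhorn2020] Definition 4.45 (2): kernels
as fibre products, monotone in factorisations).  (FK∞) «`Ker F^{(r)}` is infinitesimal (one point)» is ★
`AbelianVariety.subsingleton_ker_relFrobenius_left` (the relative Frobenius is a bijection on points) and is CITED, not restated.  (ÉT):
[Tate1997FiniteFlatGroupSchemes] (3.7) ∕ [MumfordAV1970] §14 «there are no non-trivial homomorphisms from an infinitesimal group scheme to an
étale one» — ★ (E1′) `GroupSchemes.hom_eq_toUnit_comp_unit_of_subsingleton_of_etale` applied to the one-point `Ker F^{(r)}`.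

* §1 (any cartesian monoidal category) KERNEL MONOTONICITY along a factorisation `f ≫ v = h`: `comp_eq_one_of_comp_eq_one_of_fac` (points),
  `kerι_comp_eq_one_of_fac`, `exists_hom_ker_of_fac` (`Ker f → Ker h`, a monomorphic homomorphism over the inclusions); over a base scheme with
  separated targets the comparison is a closed immersion: `exists_closedImmersion_ker_of_fac`.
* §2 (abelian varieties over a perfect field of characteristic `p`, `q = p^r`) **(FK0)** `comp_pow_zsmul_id_eq_one_of_comp_relFrobenius_eq_one`
  («a point killed by `F_q` is killed by `q`»), `kerι_relFrobenius_comp_pow_zsmul_id` (`ι_{A[F_q]} ≫ [q] = 1`),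
  `exists_closedImmersion_ker_relFrobenius_ker_pow_zsmul_id` («`A[F_q] ⊆ A[q]` as a closed subgroup scheme»).
* §3 (abelian varieties over any field of exponential characteristic `p`) **(ÉT)** `hom_ker_relFrobenius_eq_toUnit_comp_unit_of_etale`,
  `hom_ker_relFrobenius_eq_one_of_etale` («Hom(`A[F_q]`, étale) = 1»), and the block form `exists_closedImmersion_ker_relFrobenius_forall_etale`
  (the inclusion `A[F_q] ↪ A[q]` composed with ANY homomorphism `A[q] → E` to an étale group scheme `E` — e.g. the projector onto an étale block —
  is trivial).

## References
* [MumfordAV1970] D. Mumford, *Abelian Varieties* (1970), §14 (étale and local group schemes), §15 (p. 146: `F_{A∕k}`, `Ker F` infinitesimal).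
* [EdixhovenVanDerGeerMoonenAV] B. Edixhoven, G. van der Geer, B. Moonen, *Abelian Varieties* (book draft), Ch. 5 §2 (`V ∘ F = [p]`, `F ∘ V = [p]`).
* [Tate1997FiniteFlatGroupSchemes] J. Tate, *Finite flat group schemes*, in: Modular Forms and Fermat's Last Theorem (1997), (3.7) (connected–étale
  sequence; `Hom(connected, étale) = 0` over a field).
* [GortzWedhorn2020] U. Görtz, T. Wedhorn, *Algebraic Geometry I* (2nd ed. 2020), Definition 4.45 (2) (p. 117: kernels of group-scheme homomorphisms).
-/

set_option autoImplicit false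

universe v u

open CategoryTheory Limits MonoidalCategory CartesianMonoidalCategory AlgebraicGeometry

noncomputable section

/-! ## §1 Kernel monotonicity along a factorisation `f ≫ v = h` -/

namespace Literature.AlgebraicGeometry.GroupSchemes.GroupSchemeKernel

open scoped MonObj

section General

variable {C : Type u} [Category.{v} C] [CartesianMonoidalCategory C]
variable {G H K : C} [GrpObj H] [GrpObj K] {f : G ⟶ H} {v : H ⟶ K} {h : G ⟶ K} [IsMonHom v]

/-- **Kernel monotonicity, points form.**  If `f ≫ v = h` with `v` a homomorphism, a `T`-point of `G` killed by `f` is killed by `h`: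
`t ≫ f = 1 ⟹ t ≫ h = t ≫ f ≫ v = 1 ≫ v = 1`. [cite: GortzWedhorn2020, Definition 4.45 (2) (p. 117)] -/
theorem comp_eq_one_of_comp_eq_one_of_fac (hfac : f ≫ v = h) {T : C} (t : T ⟶ G) (ht : t ≫ f = 1) : t ≫ h = 1 := by
  rw [← hfac, ← Category.assoc, ht, MonObj.one_comp]

variable [HasPullback f η[H]]

/-- **Kernel monotonicity on the kernel object**: if `f ≫ v = h` with `v` a homomorphism then `ι_{Ker f} ≫ h = 1`.
[cite: GortzWedhorn2020, Definition 4.45 (2) (p. 117)] -/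
theorem kerι_comp_eq_one_of_fac (hfac : f ≫ v = h) : kerι f ≫ h = 1 :=
  comp_eq_one_of_comp_eq_one_of_fac hfac (kerι f) (kerι_comp f)

variable [GrpObj G] [IsMonHom f] [IsMonHom h] [HasPullback h η[K]]

/-- **`Ker f ⊆ Ker h` when `h` factors through `f`** (def-free packaging of `kerLift ι_{Ker f}`): there is a homomorphism `i : Ker f → Ker h`,
a monomorphism, with `i ≫ ι_{Ker h} = ι_{Ker f}`. [cite: GortzWedhorn2020, Definition 4.45 (2) (p. 117)] -/
theorem exists_hom_ker_of_fac (hfac : f ≫ v = h) :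
    ∃ i : ker f ⟶ ker h, i ≫ kerι h = kerι f ∧ IsMonHom i ∧ Mono i := by
  refine ⟨kerLift (kerι f) (kerι_comp_eq_one_of_fac hfac), kerLift_ι _ _, isMonHom_kerLift _ _, ?_⟩
  haveI := mono_kerι f
  exact mono_of_mono_fac (kerLift_ι (f := h) (kerι f) (kerι_comp_eq_one_of_fac hfac))

end General

section Schemes

variable {S : Scheme.{u}} {G H K : Over S} [GrpObj G] [GrpObj H] [GrpObj K] {f : G ⟶ H} {v : H ⟶ K} {h : G ⟶ K}
  [IsMonHom f] [IsMonHom v] [IsMonHom h]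

/-- **`Ker f ⊆ Ker h` as CLOSED subgroup schemes** (targets separated over `S`): if `f ≫ v = h` there is a homomorphism `i : Ker f → Ker h`
over the inclusions into `G` whose underlying morphism of schemes is a closed immersion (`ι_{Ker f} = i ≫ ι_{Ker h}` is a closed immersion and
`ι_{Ker h}` is separated). [cite: GortzWedhorn2020, Definition 4.45 (2) (p. 117)] -/
theorem exists_closedImmersion_ker_of_fac [IsSeparated H.hom] [IsSeparated K.hom] (hfac : f ≫ v = h) :
    ∃ i : ker f ⟶ ker h, i ≫ kerι h = kerι f ∧ IsMonHom i ∧ IsClosedImmersion i.left := by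
  obtain ⟨i, hi, hmon, -⟩ := exists_hom_ker_of_fac hfac
  refine ⟨i, hi, hmon, ?_⟩
  haveI := isClosedImmersion_kerι_left_of_isSeparated f
  haveI := isClosedImmersion_kerι_left_of_isSeparated h
  haveI : IsClosedImmersion (i.left ≫ (kerι h).left) := by
    rw [← Over.comp_left, hi]; infer_instance
  exact IsClosedImmersion.of_comp i.left (kerι h).left

end Schemes

end Literature.AlgebraicGeometry.GroupSchemes.GroupSchemeKernel

namespace Literature.AlgebraicGeometry.Motives.AbelianVariety

open Literature.AlgebraicGeometry.GroupSchemes Literature.AlgebraicGeometry.GroupSchemes.GroupSchemeKernel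
open scoped MonObj

/-! ## §2 (FK0) `A[F_q] ⊆ A[q]` over a perfect field -/

section Perfect

variable {k : Type u} [Field k] [PerfectField k] (p : ℕ) [Fact p.Prime] [CharP k p] (A : AbelianVariety k) (r : ℕ)

/-- **(FK0), points form: a point of `A` killed by the relative `p^r`-Frobenius is killed by `[p^r]`.**  For every `k`-scheme `T` and every
`T`-point `t` of `A` with `t ≫ F^{(r)}_{A∕k} = 1` one has `t ≫ [p^r]_A = 1`, because `[p^r]_A = F^{(r)} ≫ V^{(r)}` (★ Verschiebung).
[cite: MumfordAV1970, §15 (p. 146)] [cite: EdixhovenVanDerGeerMoonenAV, Ch. 5 §2 (`V ∘ F = [p]`)] -/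
theorem comp_pow_zsmul_id_eq_one_of_comp_relFrobenius_eq_one {T : Over (Spec (.of k))} (t : T ⟶ A.X)
    (ht : t ≫ (A.relFrobenius p r).hom.hom.hom = 1) : t ≫ ((((p ^ r : ℕ) : ℤ) • 𝟙 A).hom.hom.hom) = 1 := by
  obtain ⟨V, hV, -⟩ := A.existsUnique_relFrobenius_comp_eq_pow_zsmul_id p r
  have hfac : (A.relFrobenius p r).hom.hom.hom ≫ V.hom.hom.hom = ((((p ^ r : ℕ) : ℤ) • 𝟙 A).hom.hom.hom) :=
    congrArg (fun φ => φ.hom.hom.hom) hV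
  exact comp_eq_one_of_comp_eq_one_of_fac hfac t ht

/-- **(FK0) on the kernel: `ι_{A[F_q]} ≫ [q]_A = 1`** (`q = p^r`): the inclusion of the Frobenius kernel `Ker F^{(r)}_{A∕k} ↪ A` is killed by
`[p^r]_A = F^{(r)} ≫ V^{(r)}`. [cite: MumfordAV1970, §15 (p. 146)] [cite: EdixhovenVanDerGeerMoonenAV, Ch. 5 §2 (`V ∘ F = [p]`)] -/
theorem kerι_relFrobenius_comp_pow_zsmul_id :
    kerι (A.relFrobenius p r).hom.hom.hom ≫ ((((p ^ r : ℕ) : ℤ) • 𝟙 A).hom.hom.hom) = 1 :=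
  A.comp_pow_zsmul_id_eq_one_of_comp_relFrobenius_eq_one p r _ (kerι_comp _)

/-- **(FK0) as closed subgroup schemes: `A[F_q] ⊆ A[q]`.**  There is a homomorphism `i : Ker F^{(r)}_{A∕k} → A[p^r] := Ker [p^r]_A` over the
two inclusions into `A` whose underlying morphism of `k`-schemes is a closed immersion. [cite: MumfordAV1970, §15 (p. 146)]
[cite: EdixhovenVanDerGeerMoonenAV, Ch. 5 §2 (`V ∘ F = [p]`)] [cite: GortzWedhorn2020, Definition 4.45 (2) (p. 117)] -/
theorem exists_closedImmersion_ker_relFrobenius_ker_pow_zsmul_id :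
    ∃ i : ker (A.relFrobenius p r).hom.hom.hom ⟶ ker ((((p ^ r : ℕ) : ℤ) • 𝟙 A).hom.hom.hom),
      i ≫ kerι _ = kerι _ ∧ IsMonHom i ∧ IsClosedImmersion i.left := by
  obtain ⟨V, hV, -⟩ := A.existsUnique_relFrobenius_comp_eq_pow_zsmul_id p r
  have hfac : (A.relFrobenius p r).hom.hom.hom ≫ V.hom.hom.hom = ((((p ^ r : ℕ) : ℤ) • 𝟙 A).hom.hom.hom) :=
    congrArg (fun φ => φ.hom.hom.hom) hV
  exact exists_closedImmersion_ker_of_fac hfac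

end Perfect

/-! ## §3 (ÉT) `A[F_q]` maps trivially to étale group schemes -/

section Etale

variable {k : Type u} [Field k] (p : ℕ) [ExpChar k p] (A : AbelianVariety k) (r : ℕ)

/-- **(ÉT) «Hom(`A[F_q]`, étale) = 1», unit-compatible morphisms.**  `Ker F^{(r)}_{A∕k}` has one point (★ (FK∞)
`subsingleton_ker_relFrobenius_left`), so every unit-compatible `k`-morphism from it to an ÉTALE monoid object `E` of `Over (Spec k)` is the
trivial one `toUnit ≫ η_E` (★ (E1′) `hom_eq_toUnit_comp_unit_of_subsingleton_of_etale`). [cite: Tate1997FiniteFlatGroupSchemes, (3.7)]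
[cite: MumfordAV1970, §14 and §15 (p. 146)] -/
theorem hom_ker_relFrobenius_eq_toUnit_comp_unit_of_etale {E : Over (Spec (.of k))} [MonObj E] [Etale E.hom]
    (f : ker (A.relFrobenius p r).hom.hom.hom ⟶ E) (hf : η[ker (A.relFrobenius p r).hom.hom.hom] ≫ f = η[E]) :
    f = toUnit _ ≫ η[E] := by
  haveI := subsingleton_ker_relFrobenius_left p r A
  exact hom_eq_toUnit_comp_unit_of_subsingleton_of_etale f hf

/-- **(ÉT) «Hom(`A[F_q]`, étale) = 1», homomorphisms**: every homomorphism from `Ker F^{(r)}_{A∕k}` to an étale monoid object `E` of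
`Over (Spec k)` is `1`. [cite: Tate1997FiniteFlatGroupSchemes, (3.7)] [cite: MumfordAV1970, §14 and §15 (p. 146)] -/
theorem hom_ker_relFrobenius_eq_one_of_etale {E : Over (Spec (.of k))} [MonObj E] [Etale E.hom]
    (f : ker (A.relFrobenius p r).hom.hom.hom ⟶ E) [IsMonHom f] : f = 1 := by
  rw [A.hom_ker_relFrobenius_eq_toUnit_comp_unit_of_etale p r f (IsMonHom.one_hom f), Hom.one_def]

/-- (ÉT), points form read on `A`: for a homomorphism `g : A → E` to an étale group scheme (for instance a quotient map onto an étale block),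
`ι_{A[F_q]} ≫ g = 1`. [cite: Tate1997FiniteFlatGroupSchemes, (3.7)] [cite: MumfordAV1970, §14 and §15 (p. 146)] -/
theorem kerι_relFrobenius_comp_eq_one_of_etale {E : Over (Spec (.of k))} [GrpObj E] [Etale E.hom] (g : A.X ⟶ E) [IsMonHom g] :
    kerι (A.relFrobenius p r).hom.hom.hom ≫ g = 1 :=
  A.hom_ker_relFrobenius_eq_one_of_etale p r _

end Etale

/-! ### The block form: `A[F_q] ↪ A[q] → E` is trivial for every étale `E` -/

section Block

variable {k : Type u} [Field k] [PerfectField k] (p : ℕ) [Fact p.Prime] [CharP k p] (A : AbelianVariety k) (r : ℕ)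

/-- **(FK0) + (FK∞) + (ÉT), the block form.**  `q = p^r`.  There is a closed subgroup embedding `i : A[F_q] ↪ A[q]` (over the inclusions into
`A`) such that for EVERY homomorphism `π : A[q] → E` to an étale group scheme `E` over `k` — e.g. the projector of `A[q]` onto an étale
`v`-block `A[v^∞][q]` under the idempotents of `𝒪_F ⊗ ℤ_p` — the composite `i ≫ π` is trivial: «`ε_v A[F_q] = 1` on étale blocks».
[cite: MumfordAV1970, §14 and §15 (p. 146)] [cite: EdixhovenVanDerGeerMoonenAV, Ch. 5 §2 (`V ∘ F = [p]`)] [cite: Tate1997FiniteFlatGroupSchemes, (3.7)] -/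
theorem exists_closedImmersion_ker_relFrobenius_forall_etale :
    ∃ i : ker (A.relFrobenius p r).hom.hom.hom ⟶ ker ((((p ^ r : ℕ) : ℤ) • 𝟙 A).hom.hom.hom),
      i ≫ kerι _ = kerι _ ∧ IsMonHom i ∧ IsClosedImmersion i.left ∧
        ∀ (E : Over (Spec (.of k))) [GrpObj E] [Etale E.hom] (π : ker ((((p ^ r : ℕ) : ℤ) • 𝟙 A).hom.hom.hom) ⟶ E) [IsMonHom π],
          i ≫ π = 1 := by
  obtain ⟨i, hi, hmon, hci⟩ := A.exists_closedImmersion_ker_relFrobenius_ker_pow_zsmul_id p r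
  refine ⟨i, hi, hmon, hci, fun E _ _ π _ => ?_⟩
  haveI := hmon
  exact A.hom_ker_relFrobenius_eq_one_of_etale p r (i ≫ π)

end Block

end Literature.AlgebraicGeometry.Motives.AbelianVariety

end
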